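import Summits.FinalStateConjecture.FinalStateConjecture.Statement
import HarnessLib

/-!
# Route StarvedNecks — the rev-1 generic import `HonestFixedRadiusSettling` (item stmt-FinalStateConjecture-13550)
# is a corollary of its re-typed successor `HonestFixedRadiusSettlingT` (item stmt-FinalStateConjecture-17575)

Support file of item stmt-FinalStateConjecture-13550 (lead c8 of its crux chain, 2026-08-16).

On 2026-08-16T21:18Z the summit `FinalStateConjecture` was re-typed (D-0032: TAME Christodoulou genericity
`InitialDataSet.IsTameChristodoulouGeneric`, the intrinsic lower bound `RaysStayInClosure` on the settled
region, honest growing radii in `HasExhaustiveCharts`, `IsFutureOriented`), and at 23:23Z route StarvedNecks was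
re-lined (route-repair, rev 2/3).  Its generic import is now
G′ = `Summit.FinalStateConjecture.FinalStateConjecture.Theses.StarvedNecks.HonestFixedRadiusSettlingT`: TAME
genericity, in `admissibleVacuumData X`, of "an MGHD exists, and every MGHD has complete `𝓘⁺` and carries an
honest `C⁴` fixed-radius decomposition of its self-determined exterior `O`, with `RaysStayInClosure 𝒟 O` and
pairwise distinct asymptotic four-velocities"; the rev-1 declaration
G = `Summit.FinalStateConjecture.FinalStateConjecture.Theses.StarvedNecks.HonestFixedRadiusSettling` (PLAIN,
topology-free genericity `IsChristodoulouGeneric`; no rays clause; no velocity clause) stays in the route file as a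
superseded support edge, because landed Theorems name it.

This file records in the tree that **G is a corollary of G′** (`honestFixedRadiusSettling_of_T`), so that item
13550 carries no proof obligation of its own once 17575 is settled: tame genericity implies the topology-free
notion (`IsTameChristodoulouGeneric.isChristodoulouGeneric` — forget the end, the `wDist`-continuity and the
immersion), Christodoulou genericity is antitone in the exceptional set, and G′'s pointwise property implies G's
(drop the rays clause and the distinct-velocity clause; the let-bound bundles `Hc` = HonestCore and `Hf` =
HonestFar are byte-identical in the two items).  Both statements are written out VERBATIM — the shared let-bound
bundles `Hc`, `Hf` hoisted once, then `(tail of HonestFixedRadiusSettlingT) → tail of HonestFixedRadiusSettling`,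
each tail the text after the bundles as rendered in `Theses/StarvedNecks.lean` rev 3 (the type ζ/δ-reduces to
`HonestFixedRadiusSettlingT → HonestFixedRadiusSettling`) — and the file is Theses-free, so that the eventual closing file of
13550 (`… := honestFixedRadiusSettling_of_T <proof of 17575>`) can import it without an import cycle.  The
companion check `example : Theses.StarvedNecks.HonestFixedRadiusSettlingT → Theses.StarvedNecks.HonestFixedRadiusSettling
:= honestFixedRadiusSettling_of_T` elaborates against the rev-3 route file (lead c8 work file `work/CheckOfT.lean`).

Not here: any claim about G′ itself (an open problem: generic weak cosmic censorship + finitely many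
sub-extremal Kerr holes, in tame form), nor about the converse G → G′ (false in intent: G is witnessed modulo the
retired mass-blow-up burial atoms, `Theorems.StarvedNecksHonestFixedRadiusSettlingSheetBurialLine`, which are not
tame).

References: Christodoulou, CQG 16 (1999) A23, p. A24 (genericity by positive codimension in a fixed space of data
with fixed asymptotics); Dafermos–Rodnianski, arXiv:0811.0354, App. B.2.3 (the weighted class); lead c5's repair
kit `Cruxes/HonestFixedRadiusSettling/RetypeKitC5.lean` (`honestFixedRadiusSettling_of_T`, same proof shape, for
the kit's own copy of G′ without the velocity clause).
-/

-- the doubled `FinalStateConjecture` path component is the summit/problem naming scheme, not a mistake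
set_option linter.dupNamespace false

noncomputable section

namespace Summit.FinalStateConjecture.FinalStateConjecture.Theorems.StarvedNecks.Retype

open scoped Manifold ContDiff ENNReal Topology
open Filter Set Literature.Geometry.Lorentzian

/-- Tame Christodoulou genericity of `P` (codimension `1`) implies plain Christodoulou genericity of every
pointwise-weaker property `Q` on the admissible class: forget tameness
(`IsTameChristodoulouGeneric.isChristodoulouGeneric`), then use that genericity is antitone in the exceptional
set (the same witness curve through a `Q`-exceptional datum, which is `P`-exceptional). Christodoulou, CQG 16
(1999) A23, p. A24. [folklore] -/
private theorem isChristodoulouGeneric_of_tame_of_imp {X : Type} [TopologicalSpace X] [ChartedSpace E3 X]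
    [IsManifold (𝓡 3) ∞ X] {𝓓 : Set (InitialDataSet (𝓡 3) X)} {P Q : InitialDataSet (𝓡 3) X → Prop}
    (hPQ : ∀ D ∈ 𝓓, P D → Q D) (hP : InitialDataSet.IsTameChristodoulouGeneric 𝓓 P 1) :
    InitialDataSet.IsChristodoulouGeneric 𝓓 Q 1 := by
  intro d hd
  obtain ⟨F, hF, h0, hinj, hmem, hE⟩ :=
    hP.isChristodoulouGeneric d ⟨hd.1, fun h ↦ hd.2 (hPQ d hd.1 h)⟩
  exact ⟨F, hF, h0, hinj, hmem, fun c hc hc' ↦ hE c hc ⟨hc'.1, fun h ↦ hc'.2 (hPQ _ hc'.1 h)⟩⟩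

/-- **G′ → G: the rev-1 generic import of route StarvedNecks follows from its re-typed successor.**
Hypothesis = the body of `Theses.StarvedNecks.HonestFixedRadiusSettlingT` (item stmt-FinalStateConjecture-17575)
verbatim: for every admissible `3`-manifold `X`, TAME-Christodoulou-generically in `admissibleVacuumData X`, the
datum has an MGHD and every MGHD `𝒟` has complete `𝓘⁺` and admits `(O, d, R₀)` — a `C⁴`
`FinalStateDecomposition` `d` of `O = exteriorOf 𝒟 d.charted` — with `RaysStayInClosure 𝒟 O`,
`HonestCore(d, R₀)`, `HonestFar(d, R₀)` and pairwise distinct asymptotic four-velocities `Λᵢ e₀ ≠ Λⱼ e₀`.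
Conclusion = the body of `Theses.StarvedNecks.HonestFixedRadiusSettling` (item stmt-FinalStateConjecture-13550)
verbatim: the same with PLAIN Christodoulou genericity and without the rays and velocity clauses.
Proof: introduce the conclusion's let-bound `Hc`, `Hf` (byte-identical to the hypothesis's), specialise the
hypothesis at `X`, and apply `isChristodoulouGeneric_of_tame_of_imp` to the pointwise implication that forgets
the two extra conjuncts. Christodoulou, CQG 16 (1999) A23, p. A24; Dafermos–Luk arXiv:1710.01722, Conjecture 1.
[folklore] -/
theorem honestFixedRadiusSettling_of_T :
    open Literature.Geometry.Lorentzian in open scoped ContDiff ENNReal in let Hc := ( fun (𝓢 : Spacetime.{0} 4) (O : Set 𝓢.carrier) (k : ℕ) (d : FinalStateDecomposition 𝓢 O k) (R₀ : ℝ) => let B := d.background; let t := fun i ↦ (B i).time; let r := fun i ↦ (B i).radius; let Ψ := d.chart; (∀ i, Kerr.IsSubextremal (d.mass i) (d.spin i) ∧ 100 * d.mass i ≤ R₀ ∧ 0 < ((d.motion i).1 : E4 ≃L[ℝ] E4) (E4.basisVector 0) 0) ∧ (∀ i (ϱ τ₂ : ℝ), R₀ ≤ ϱ → d.τ₀ <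 τ₂ → Ψ i '' {x | d.τ₀ < t i x.1 ∧ t i x.1 < τ₂ ∧ r i x.1 < ϱ} ⊆ 𝓢.metric.causalPast 𝓢.timeOrientation (Ψ i '' (B i).truncTimeSlab ϱ τ₂)) ∧ (∀ i (τ' : ℝ) (ϱ : ℝ → ℝ), Continuous ϱ → d.τ₀ < τ' → let A := Ψ i '' {x | τ' ≤ t i x.1 ∧ r i x.1 ≤ ϱ (t i x.1)}; closure A ∩ O ⊆ A) ∧ (∀ y : d.flatDomain, d.τ₀ < y.1 0 → 𝓢.timeOrientation.IsFutureDirected (mfderiv 𝓘(ℝ, E4) (𝓡 4) d.flatChart y (E4.basisVector 0))) ); let Hf := ( fun (𝓢 : Spacetime.{0} 4) (O : Set 𝓢.carrier) (k : ℕ) (d : FinalStateDecomposition 𝓢 O k) (R₀ : ℝ) => let B := d.background; let t := fun i ↦ (B i).time; let r := fun i ↦ (B i).radius; let Φ := d.flatChart; (∀ τ₂ : ℝ, d.τ₀ < τ₂ → Φ '' {y | d.τ₀ < y.1 0 ∧ y.1 0 < τ₂} ⊆ 𝓢.metric.causalPast 𝓢.timeOrientation (Φ '' (Minkowski.backgroundOn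 d.flatDomain).timeSlab τ₂)) ∧ (∀ τ' : ℝ, d.τ₀ < τ' → closure (Φ '' {y | τ' ≤ y.1 0 ∧ ∀ i, d.excision i (y.1 0) + 1 ≤ r i y.1}) ⊆ Φ '' {y | τ' ≤ y.1 0}) ∧ (∀ i, ∃ T : ℝ, supCkENorm (Subtype.val '' {x : (B i).domain | T ≤ t i x.1 ∧ R₀ ≤ r i x.1 ∧ ∀ j, j ≠ i → r i x.1 ≤ r j x.1}) 0 (𝓢.deviationExtend (B i) (d.chart i)) ≤ ENNReal.ofReal (1 / (10 * ‖(((d.motion i).1 : E4 ≃L[ℝ] E4) : E4 →L[ℝ] E4)‖ ^ 2))) ); (∀ (X : Type) [TopologicalSpace X] [ChartedSpace E3 X] [IsManifold (𝓡 3) ∞ X] [T2Space X] [SecondCountableTopology X] [ConnectedSpace X], InitialDataSet.IsTameChristodoulouGeneric (admissibleVacuumData X) (fun D ↦ (∃ 𝒟 : VacuumCauchyDevelopment D, 𝒟.IsMaximal) ∧ ∀ 𝒟 : VacuumCauchyDevelopment D, 𝒟.IsMaximal → HasCompleteNullInfinity 𝒟.toCauchyDevelopment ∧ ∃ (O : Set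 𝒟.carrier) (d : FinalStateDecomposition 𝒟.toSpacetime O 4) (R₀ : ℝ), O = exteriorOf 𝒟.toCauchyDevelopment d.charted ∧ RaysStayInClosure 𝒟.toCauchyDevelopment O ∧ Hc 𝒟.toSpacetime O 4 d R₀ ∧ Hf 𝒟.toSpacetime O 4 d R₀ ∧ (∀ i j : Fin d.N, i ≠ j → ((d.motion i).1 : E4 ≃L[ℝ] E4) (E4.basisVector 0) ≠ ((d.motion j).1 : E4 ≃L[ℝ] E4) (E4.basisVector 0))) 1) → ∀ (X : Type) [TopologicalSpace X] [ChartedSpace E3 X] [IsManifold (𝓡 3) ∞ X] [T2Space X] [SecondCountableTopology X] [ConnectedSpace X], InitialDataSet.IsChristodoulouGeneric (admissibleVacuumData X) (fun D ↦ (∃ 𝒟 : VacuumCauchyDevelopment D, 𝒟.IsMaximal) ∧ ∀ 𝒟 : VacuumCauchyDevelopment D, 𝒟.IsMaximal → HasCompleteNullInfinity 𝒟.toCauchyDevelopment ∧ ∃ (O : Set 𝒟.carrier) (d : FinalStateDecomposition 𝒟.toSpacetime O 4) (R₀ : ℝ), O = exteriorOf 𝒟.toCauchyDevelopment d.charted ∧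 Hc 𝒟.toSpacetime O 4 d R₀ ∧ Hf 𝒟.toSpacetime O 4 d R₀) 1 := by
  intro Hc Hf hT X _ _ _ _ _ _
  refine isChristodoulouGeneric_of_tame_of_imp ?_ (hT X)
  rintro D - ⟨hex, hall⟩
  refine ⟨hex, fun 𝒟 h𝒟 ↦ ?_⟩
  obtain ⟨hscri, O, d, R₀, hO, -, hcore, hfar, -⟩ := hall 𝒟 h𝒟
  exact ⟨hscri, O, d, R₀, hO, hcore, hfar⟩

end Summit.FinalStateConjecture.FinalStateConjecture.Theorems.StarvedNecks.Retype

end
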